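import Summits.FinalStateConjecture.FinalStateConjecture.Theorems.BartnikGapSettlingGapExhaustionIKStepNormalisedDataT
import HarnessLib

/-!
# Crux `GapExhaustion` (stmt-FinalStateConjecture-10808), line `photon-shell-pseudoconvexity`:
# stub (F1a) `stub_ikQuant6TFar` — the `T`-CONDITIONAL quantitative pseudo-convexity of the
# normalised data at a FAR cylinder point (scale `s = c · su`)

Route `BartnikGapSettling`; helper (`--supports stmt-FinalStateConjecture-10808`) of line lead
c12 (wave 4, far chain F1a), the far twin of `stub_ikQuant6T` (file
`BartnikGapSettlingGapExhaustionIKStepNormalisedDataT`). Data: a metric datum `G` on an open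
`W ⊆ E4` with `ricAt G = 0`, a point `x ∈ W` on the cylinder `{r = c}` with `c = r(x)` LARGE, an
exact frame `L` at `x` (`G x (L·, L·) = η`, `‖L‖, ‖L⁻¹‖ ≤ 6`), a unit fraction `0 < su ≤ 1`, the
far scale `s = c · su`, `Ls = s L`, the normalised data `Gt y = s⁻² G(x + Ls y) ∘ (Ls × Ls)`, the
scale-free defining function `ft y = c s⁻² (r(x + Ls y) − c)` and the scale-free conditioning
vector `τ = c • Ls⁻¹ ∂₀` of the normalised chart. From the `T`-conditional multiplier form at `x`
with the extra factor `c` on the Hessian (penalty `ε₁⁻² ((G x ∂₀ w)² + (Dr(x) w)²)`,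
Ionescu–Klainerman's conditional pseudo-convexity, Surveys Diff. Geom. 2015 Lemma 2.17, in the
multiplier form of JAMS 2013 Lemma 2.11) we derive, with one constant `A₁`: `‖D ft(0)‖ ≥ A₁⁻¹`,
`A₁⁻¹ ≤ ‖τ‖ ≤ A₁`, and the conditional (quant6) at the origin with penalty
`A₁ ((D ft(0) X)² + (Gt 0 τ X)²)`, using `D ft(0) = su⁻¹ Dr(x) ∘ L`, `τ = su⁻¹ L⁻¹ ∂₀`,
`Gt 0 τ X = su⁻¹ G x ∂₀ (L X)`, `Hess_{Gt} ft (0) (X, X) = c Hess_G r (x) (L X, L X)` (the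
tensoriality of the coordinate Hessian under the affine change, `affineCov_hessAt`): every `c`
cancels against the scale and IK's constants stay scale-free. Nothing about the far Kerr bounds or
the far multiplier form itself is proved here (neighbouring stubs).
-/

noncomputable section

set_option maxSynthPendingDepth 3

-- D-0017: single-problem summit, `Summit.<S>.<S>.…` by design (cf. lakefile `weak.linter.dupNamespace`).
set_option linter.dupNamespace false

namespace Summit.FinalStateConjecture.FinalStateConjecture.Theorems

open Set Function Metric
open Literature.Geometry.Lorentzian Literature.Geometry.Lorentzian.MetricCoord
open scoped Manifold ContDiff Topology ENNReal

/-! ### Helpers on the far scale `s = c · su` -/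

/-- The far scale identity: `c · s⁻¹ = su⁻¹` for `s = c · su`, `c ≠ 0`. [folklore] -/
theorem ikStepTFar_mul_inv {c s su : ℝ} (hc : c ≠ 0) (hs : s = c * su) : c * s⁻¹ = su⁻¹ := by
  rw [hs, mul_inv, ← mul_assoc, mul_inv_cancel₀ hc, one_mul]

/-- The scaled frame with the unit fraction: for `su ≠ 0` there is `Lsu` with `Lsu v = su • L v`.
[folklore] -/
theorem ikStepTFar_exists_smul_equiv (L : E4 ≃L[ℝ] E4) {su : ℝ} (hsu : su ≠ 0) :
    ∃ Lsu : E4 ≃L[ℝ] E4, ∀ v : E4, Lsu v = su • L v := by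
  obtain ⟨Lsu, hLsu, _⟩ := ikStep_exists_smul_equiv L hsu
  refine ⟨Lsu, fun v ↦ ?_⟩
  simpa using DFunLike.congr_fun hLsu v

/-- The scale-free conditioning vector: `c • Ls⁻¹ ∂₀ = su⁻¹ • L⁻¹ ∂₀` for `Ls = s L`,
`s = c · su`. [folklore] -/
theorem ikStepTFar_tau_eq {c s su : ℝ} {L Ls : E4 ≃L[ℝ] E4} {τ : E4} (hc : c ≠ 0) (hs0 : s ≠ 0)
    (hs : s = c * su) (hLs : ∀ v : E4, Ls v = s • L v)
    (hτ : τ = c • (Ls.symm : E4 →L[ℝ] E4) (E4.basisVector 0)) :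
    τ = su⁻¹ • L.symm (E4.basisVector 0) := by
  rw [hτ, ContinuousLinearEquiv.coe_coe, ikStepT_symm_apply hs0 hLs, smul_smul,
    ikStepTFar_mul_inv hc hs]

/-! ### The far conditional stub -/

/-- **IK's `T`-conditional quantitative pseudo-convexity (quant6) and non-degeneracy at the
centre, FAR cylinder point** — the registered stub (F1a) of line `photon-shell-pseudoconvexity`,
crux `GapExhaustion` (stmt-FinalStateConjecture-10808), far twin of `stub_ikQuant6T`: at a far
point the scale is `s = c · su` with `c = r(x)` large and `0 < su ≤ 1`, the defining function
`ft y = c s⁻² (r(x + Ls y) − c)` and the conditioning vector `τ = c • Ls⁻¹ ∂₀` carry the extra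
factor `c`, and the multiplier form at `x` has `c · Hess_G r (x)`; from it (penalty
`ε₁⁻² ((G x ∂₀ w)² + (Dr(x) w)²)`, the multiplier form of Ionescu–Klainerman's `T`-conditional
pseudo-convexity) we get `‖D ft(0)‖ ≥ A₁⁻¹`, `A₁⁻¹ ≤ ‖τ‖ ≤ A₁` and (quant6) at the origin with
penalty `A₁ ((D ft(0) X)² + (Gt 0 τ X)²)`, via `D ft(0) = su⁻¹ Dr(x) ∘ L`, `τ = su⁻¹ L⁻¹ ∂₀`,
`Gt 0 τ X = su⁻¹ G x ∂₀ (L X)` and `Hess_{Gt} ft (0)(X, X) = c Hess_G r (x)(L X, L X)`.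
[cite: IonescuKlainerman2015, Lemma 2.17] -/
theorem stub_ikQuant6TFar : ∀ (G : E4 → E4 →L[ℝ] E4 →L[ℝ] ℝ) (W : Set E4) (a c s su : ℝ) (x : E4) (L Ls : E4 ≃L[ℝ] E4) (Gt : E4 → E4 →L[ℝ] E4 →L[ℝ] ℝ) (ft : E4 → ℝ) (τ : E4) (ν ε₁ μ₀ A₁ : ℝ), IsMetricOn G W → (∀ z ∈ W, ricAt G z = 0) → x ∈ W → 0 < c → 0 < su → su ≤ 1 → s = c * su → (∀ v : E4, Ls v = s • L v) → (∀ v w : E4, G x (L v) (L w) = Minkowski.bilin v w) → ‖(L : E4 →L[ℝ] E4)‖ ≤ 6 → ‖(L.symm : E4 →L[ℝ] E4)‖ ≤ 6 → (∀ y : E4, Gt y = (s ^ 2)⁻¹ • (G (x + Ls y)).bilinearComp (Ls : E4 →L[ℝ] E4) (Ls : E4 →L[ℝ] E4)) → Kerr.radius a x = c → (∀ y : E4, ft y = c * (s ^ 2)⁻¹ * (Kerr.radius a (x + Ls y) - c)) → τ = c • (Ls.symm : E4 →L[ℝ] E4) (E4.basisVector 0) → ContDiffAt ℝ ∞ (Kerr.radius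 a) x → 0 < ν → 0 < ε₁ → 0 < A₁ → ν ≤ ‖fderiv ℝ (Kerr.radius a) x‖ → |μ₀| ≤ ε₁⁻¹ → (∀ w : E4, ε₁ ^ 2 * ‖w‖ ^ 2 ≤ μ₀ * G x w w - c * hessAt G (Kerr.radius a) x w w + ε₁⁻¹ ^ 2 * ((G x (E4.basisVector 0) w) ^ 2 + (fderiv ℝ (Kerr.radius a) x w) ^ 2)) → 36 * ε₁⁻¹ ^ 2 ≤ A₁ → ε₁⁻¹ ≤ A₁ → 6 / ν ≤ A₁ → 6 / su ≤ A₁ → A₁⁻¹ ≤ ‖fderiv ℝ ft 0‖ ∧ A₁⁻¹ ≤ ‖τ‖ ∧ ‖τ‖ ≤ A₁ ∧ ∃ μ ∈ Icc (-A₁) A₁, ∀ X : E4, A₁⁻¹ * ‖X‖ ^ 2 ≤ μ * Gt 0 X X - hessAt Gt ft 0 X X + A₁ * ((fderiv ℝ ft 0 X) ^ 2 + (Gt 0 τ X) ^ 2) := by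
  intro G W a c s su x L Ls Gt ft τ ν ε₁ μ₀ A₁ hGmet hric hxW hc hsu hsu1 hs hLs hL hL6 hLs6 hGt hx hft
    hτ hr0 hν hε₁ hA₁pos hνx hμ₀ hUin hA₁ε2 hA₁ε hA₁ν hA₁su
  have hspos : 0 < s := by rw [hs]; exact mul_pos hc hsu
  have hc0 : c ≠ 0 := hc.ne'
  have hcs : c * s⁻¹ = su⁻¹ := ikStepTFar_mul_inv hc0 hs
  -- the un-multiplied defining function `ft₀ = s⁻² (r(x + Ls ·) − c)`, `ft = c ft₀`
  set ft₀ : E4 → ℝ := fun y => (s ^ 2)⁻¹ * (Kerr.radius a (x + Ls y) - c) with hft₀def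
  obtain ⟨_, _, hfd₀', hft₀sm⟩ :=
    ikStep_ft_basic (ft := ft₀) hspos hLs hx (fun y => rfl) hr0
  obtain ⟨_, _, _, hGthess, hGtap⟩ := ikStep_Gt_basic hGmet hric hspos hLs hL hGt
  have haff0 : x + Ls 0 = x := by simp
  have h0W : (0 : E4) ∈ (fun y : E4 => x + Ls y) ⁻¹' W := by
    show x + Ls 0 ∈ W; rwa [haff0]
  have hftc : ft = fun y => c * ft₀ y := by
    funext y; rw [hft, hft₀def, mul_assoc]
  have hdiff₀ : DifferentiableAt ℝ ft₀ 0 :=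
    (hft₀sm 0 (by rwa [haff0])).differentiableAt (by simp)
  -- `D ft(0) = su⁻¹ Dr(x) ∘ L`
  have hfdE : fderiv ℝ ft 0 = su⁻¹ • (fderiv ℝ (Kerr.radius a) x).comp (L : E4 →L[ℝ] E4) := by
    rw [hftc, fderiv_const_mul hdiff₀, hfd₀', smul_smul, hcs]
  have hD : ∀ X : E4, fderiv ℝ ft 0 X = su⁻¹ * fderiv ℝ (Kerr.radius a) x (L X) := by
    intro X
    rw [hfdE, smul_apply, ContinuousLinearMap.comp_apply, smul_eq_mul,
      ContinuousLinearEquiv.coe_coe]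
  have hLsτ : Ls τ = c • E4.basisVector 0 := by
    rw [hτ, map_smul, ContinuousLinearEquiv.coe_coe, ContinuousLinearEquiv.apply_symm_apply]
  -- the non-degeneracy of `D ft(0)`
  have hnorm : A₁⁻¹ ≤ ‖fderiv ℝ ft 0‖ := by
    have hcomp : ‖fderiv ℝ (Kerr.radius a) x‖ ≤
        ‖(fderiv ℝ (Kerr.radius a) x).comp (L : E4 →L[ℝ] E4)‖ * 6 :=
      (ikStep_norm_le_norm_comp_mul _ L).trans (mul_le_mul_of_nonneg_left hLs6 (norm_nonneg _))
    rw [hfdE, norm_smul, Real.norm_eq_abs, abs_of_pos (inv_pos.2 hsu)]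
    have h1 : A₁⁻¹ ≤ ν / 6 := by
      rw [inv_le_comm₀ hA₁pos (by positivity), inv_div]; exact hA₁ν
    have h2 : ν / 6 ≤ ‖(fderiv ℝ (Kerr.radius a) x).comp (L : E4 →L[ℝ] E4)‖ := by
      rw [div_le_iff₀ (by norm_num)]; exact hνx.trans hcomp
    have h3 : ‖(fderiv ℝ (Kerr.radius a) x).comp (L : E4 →L[ℝ] E4)‖ ≤
        su⁻¹ * ‖(fderiv ℝ (Kerr.radius a) x).comp (L : E4 →L[ℝ] E4)‖ := by
      have h1s : 1 ≤ su⁻¹ := (one_le_inv₀ hsu).2 hsu1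
      have hn := norm_nonneg ((fderiv ℝ (Kerr.radius a) x).comp (L : E4 →L[ℝ] E4))
      calc ‖(fderiv ℝ (Kerr.radius a) x).comp (L : E4 →L[ℝ] E4)‖
          = 1 * ‖(fderiv ℝ (Kerr.radius a) x).comp (L : E4 →L[ℝ] E4)‖ := (one_mul _).symm
        _ ≤ su⁻¹ * ‖(fderiv ℝ (Kerr.radius a) x).comp (L : E4 →L[ℝ] E4)‖ :=
          mul_le_mul_of_nonneg_right h1s hn
    exact h1.trans (h2.trans h3)
  -- the bounds on the conditioning vector `τ = su⁻¹ L⁻¹ ∂₀ = Lsu⁻¹ ∂₀`, `Lsu = su L`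
  obtain ⟨Lsu, hLsu⟩ := ikStepTFar_exists_smul_equiv L hsu.ne'
  have hτ' : τ = (Lsu.symm : E4 →L[ℝ] E4) (E4.basisVector 0) := by
    rw [ikStepTFar_tau_eq hc0 hspos.ne' hs hLs hτ, ContinuousLinearEquiv.coe_coe,
      ikStepT_symm_apply hsu.ne' hLsu]
  obtain ⟨hτ6, hτs⟩ := ikStepT_tau_bounds hsu hsu1 hLsu hL6 hLs6 hτ'
  have h6A : (6 : ℝ) ≤ A₁ := by
    have h6s : (6 : ℝ) ≤ 6 / su := by
      rw [le_div_iff₀ hsu]; nlinarith only [hsu1, hsu]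
    exact h6s.trans hA₁su
  have hτlow : A₁⁻¹ ≤ ‖τ‖ := by
    have h3 : A₁⁻¹ ≤ 6⁻¹ := by
      rw [inv_le_comm₀ hA₁pos (by norm_num), inv_inv]; exact h6A
    have h4 : (6 : ℝ)⁻¹ ≤ ‖τ‖ := by
      rw [inv_le_iff_one_le_mul₀ (by norm_num)]; linarith only [hτ6]
    exact h3.trans h4
  have hτup : ‖τ‖ ≤ A₁ := hτs.trans hA₁su
  refine ⟨hnorm, hτlow, hτup, μ₀, ⟨by linarith [(abs_le.1 hμ₀).1], (abs_le.1 hμ₀).2.trans hA₁ε⟩,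
    fun X ↦ ?_⟩
  -- the Hessian of `ft` for `Gt` at `0`, read through `G` at `x`: the `s²` cancels, the `c` stays
  have hhess : hessAt Gt ft 0 X X = c * hessAt G (Kerr.radius a) x (L X) (L X) := by
    rw [hGthess 0 h0W ft, ← affineCov_eq_pullMetric G Ls x, funext hft]
    have hg2 : ContDiffAt ℝ 2 (fun y : E4 => Kerr.radius a (x + Ls y)) 0 := by
      have haff : ContDiff ℝ 2 (fun y : E4 => x + Ls y) :=
        contDiff_const.add (Ls : E4 →L[ℝ] E4).contDiff
      have hr2 : ContDiffAt ℝ 2 (Kerr.radius a) (x + Ls 0) := by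
        rw [haff0]; exact hr0.of_le (WithTop.coe_le_coe.mpr le_top)
      have g1 := ContDiffAt.comp (g := Kerr.radius a) (f := fun y : E4 => x + Ls y) (0 : E4) hr2
        haff.contDiffAt
      simpa only [Function.comp_def] using g1
    rw [ikStep_hessAt_const_mul_sub _ hg2, smul_apply, smul_apply, smul_eq_mul,
      affineCov_hessAt G (Kerr.radius a) Ls x 0 W hGmet (by rwa [haff0])
        (by rw [haff0]; exact hr0.of_le (WithTop.coe_le_coe.mpr le_top)),
      haff0, hLs]
    simp only [map_smul, smul_apply, smul_eq_mul]
    field_simp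
  have hG0 : Gt 0 X X = G x (L X) (L X) := by
    rw [hGtap, haff0, hLs]
    simp only [map_smul, smul_apply, smul_eq_mul]
    field_simp
  have hGτ : Gt 0 τ X = su⁻¹ * G x (E4.basisVector 0) (L X) := by
    rw [hGtap, haff0, hLsτ, hLs, ← hcs]
    simp only [map_smul, smul_apply, smul_eq_mul]
    field_simp
  rw [hhess, hG0, hD, hGτ]
  -- the inequality, with `w = L X`
  have hw := hUin (L X)
  have hXn : ‖X‖ ≤ 6 * ‖L X‖ :=
    (ikStep_norm_le_mul_norm_apply L X).trans (mul_le_mul_of_nonneg_right hLs6 (norm_nonneg _))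
  have hXn2 : ‖X‖ ^ 2 ≤ 36 * ‖L X‖ ^ 2 := by
    have h := mul_self_le_mul_self (norm_nonneg X) hXn
    nlinarith only [h]
  have hA₁inv : A₁⁻¹ * 36 ≤ ε₁ ^ 2 := by
    rw [inv_mul_le_iff₀ hA₁pos]
    have h1 : 36 * ε₁⁻¹ ^ 2 * ε₁ ^ 2 = 36 := by field_simp
    have h2 : 36 * ε₁⁻¹ ^ 2 * ε₁ ^ 2 ≤ A₁ * ε₁ ^ 2 :=
      mul_le_mul_of_nonneg_right hA₁ε2 (sq_nonneg _)
    linarith only [h1, h2]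
  have hlhs : A₁⁻¹ * ‖X‖ ^ 2 ≤ ε₁ ^ 2 * ‖L X‖ ^ 2 := by
    calc A₁⁻¹ * ‖X‖ ^ 2 ≤ A₁⁻¹ * (36 * ‖L X‖ ^ 2) := by gcongr
      _ = (A₁⁻¹ * 36) * ‖L X‖ ^ 2 := by ring
      _ ≤ ε₁ ^ 2 * ‖L X‖ ^ 2 := by gcongr
  have hcoef : ε₁⁻¹ ^ 2 ≤ A₁ * su⁻¹ ^ 2 := by
    have h0 : 0 ≤ ε₁⁻¹ ^ 2 := sq_nonneg _
    have h1 : ε₁⁻¹ ^ 2 ≤ A₁ := by linarith only [hA₁ε2, h0]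
    have h2 : 1 ≤ su⁻¹ ^ 2 := one_le_pow₀ ((one_le_inv₀ hsu).2 hsu1)
    calc ε₁⁻¹ ^ 2 ≤ A₁ := h1
      _ = A₁ * 1 := (mul_one _).symm
      _ ≤ A₁ * su⁻¹ ^ 2 := mul_le_mul_of_nonneg_left h2 hA₁pos.le
  have hrhs : ε₁⁻¹ ^ 2 * (fderiv ℝ (Kerr.radius a) x (L X)) ^ 2 ≤
      A₁ * (su⁻¹ * fderiv ℝ (Kerr.radius a) x (L X)) ^ 2 := by
    rw [mul_pow, ← mul_assoc]
    exact mul_le_mul_of_nonneg_right hcoef (sq_nonneg _)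
  have hrhsT : ε₁⁻¹ ^ 2 * (G x (E4.basisVector 0) (L X)) ^ 2 ≤
      A₁ * (su⁻¹ * G x (E4.basisVector 0) (L X)) ^ 2 := by
    rw [mul_pow, ← mul_assoc]
    exact mul_le_mul_of_nonneg_right hcoef (sq_nonneg _)
  linarith [hw, hlhs, hrhs, hrhsT]

end Summit.FinalStateConjecture.FinalStateConjecture.Theorems

end
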